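import Literature.NumberTheory.LFunctions.WeilTwoPrimeCellsT120Data0
import Literature.NumberTheory.LFunctions.WeilTwoPrimeCellsT120Data1
import Literature.NumberTheory.LFunctions.WeilTwoPrimeCellsT120Data2
import Literature.NumberTheory.LFunctions.WeilTwoPrimeCellsT120Data3
import Literature.NumberTheory.LFunctions.WeilTwoPrimeCellsT120Data4
import Literature.NumberTheory.LFunctions.WeilTwoPrimeCellsT120Data5
import Literature.NumberTheory.LFunctions.WeilTwoPrimeCellsMP
import HarnessLib

/-!
# Two-prime minorant cells on `[0, 120]`: the chain, its level and the checker parameters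

The 328 cells of a certified piecewise-polynomial minorant of the two-prime Weil weight `w₂₃(t) = Re ψ(1/4+it/2) − √2 log 2 cos(t log 2) − (2 log 3/√3) cos(t log 3)` on `[0, 120]` at level `wL = 2029165557945/1099511627776` (`≈ 1.845515`; format `TPDCell`, `WeilTwoPrimeCells.lean`; MULTI-PRECISION integer checker `TPDCell.checkZMP 120 5 ⟨100, 60, 10⟩` of `WeilTwoPrimeCellsMP.lean`).  Successor of the chain on `[0, 80]` (`weilTwoPrimeCellsT80`, gap `≈ 10⁻⁹` on `[0, 30]`): same grid on `[0, 80]` plus 80 cells of width `1/2` on `[80, 120]`, series lengths `mw`, `ma` about `2–3×` larger, ripple constants from the multi-precision engine (`rippleLoMP`, slack `≈ 10⁻¹³` instead of `10⁻¹¹…5·10⁻⁹`); minorant gap `≤ 9.3e-11` (mean `4.6e-11`) on `[0, 32]`, `≤ 6.1e-10` on `[32, 80]`, `≤ 3.1e-09` on `[80, 120]` (float validation).  Built for the log-2 L-side of the `{2,3}`-window ladder of crux stmt-RiemannHypothesis-18085 (GroundBarta rung 4 prover A gen 3, `cert/designer.py` + `cert/v2build.py`: digamma value and coefficients are the extreme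 values allowed by the integer series, obtained by compiled evaluation of the checker's own functions). [cite: Yoshida1992, §6] Nothing is trusted: only kernel Booleans are consumed.
-/

noncomputable section

namespace Literature.NumberTheory.LFunctions

/-- The 328 cells of the two-prime minorant on `[0, 120]`, chained from `0` to `120` (six kernel-sized chunks). [folklore] -/
def weilTwoPrimeCellsT120 : List TPDCell :=
  weilTwoPrimeCellsT120C0 ++ weilTwoPrimeCellsT120C1 ++ weilTwoPrimeCellsT120C2 ++ weilTwoPrimeCellsT120C3 ++ weilTwoPrimeCellsT120C4 ++ weilTwoPrimeCellsT120C5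

/-- The level `wL` of the two-prime minorant on `[0, 120]` (`wL + √2 log 2 + 2 log 3/√3 ≤ Re ψ(1/4 + i120/2)`, integer-checked). [folklore] -/
def weilTwoPrimeCellsT120Level : ℚ := 2029165557945/1099511627776

/-- The multi-precision parameters used to check the ripple constants of the chain on `[0, 120]`: scale `2^100`, `60` series terms, `10` halvings. [folklore] -/
def weilTwoPrimeCellsT120MP : MPParams := ⟨100, 60, 10⟩

end Literature.NumberTheory.LFunctions
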